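import Summits.QuantumFields.BalabanUV.T4Continuum.Support.NE7LawLevelAssembly

/-!
# NE7, ROAD P4 (law-level), NODE Q.rec REDUCED: conditional dressing means are STABLE under a sandwiched tilt of the
# PATH law — the two-run part of NODE Q is the window-level sandwich (shared leaves S/W/D, shifted index) + this lemma

(Cell `pub-balaban`, sub-cell `t4`, binder row NE7 = node U5, co-owner #4 `b2b-balaban-t4-ne7-p4`; skeleton
`HOME/t4/skeletons/NE7-t4-ne7-p4.md` §2 NODE Q.  Files of the road: `NE7LawLevelSocket` p206810, `NE7LawLevelAssembly`
p207170, `NE7LawLevelTilt` p207299, `NE7LawLevelDressing` p207543.)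

HONEST FRAMING (T4-DAG PAGE 1).  Rung (B)+1 on ONE FIXED finite four-torus, CONDITIONAL on `BetaPertH` and the nine
spine estimates (0/9 proved); NOT infinite volume, NOT a mass gap, NOT the Clay problem.  NE7 is NOT PRINTED and NOT
proved here.  This file is pure [folklore] measure theory (Mathlib `Measure.tilted`, set integrals, push-forwards),
sorry-free; no statement of the audited series is asserted; NOT summit progress.

THE POINT.  On road P4 the true expectations are read through conditional dressing means `m` of a bounded path
functional `Φ` given the chain's endpoint `Y` (NODE Q).  The RECENT part of the two-run dressing-mean mismatch compares
`m` under run A's law `P` of the recent window of the chain with `m` under run B's law `Q` of the same window.  If `Q`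
is a Gibbs tilt of `P` by a path functional `f` with `|f − c| ≤ R` — i.e. the two runs' JOINT densities of the recent
window (initial level-(K − n₀) density × the synchronised averaging-and-resampling transition densities, each a product
∕ ratio ∕ fibre integral of TERM densities) are sandwiched with total radius `R` = the sum of the window's level radii
(NODE S at the levels of the window: the same producers as at the last level, shifted index) — then the dressing means
differ in `L¹(Q_Y)` by at most `2e^{2R}(e^{2R} − 1) ≈ 4R`, WHATEVER `Φ` and `Y` are.  So NODE Q's two-run leaf Q.rec is
NOT an independent estimate: Q.rec ⇐ {window-level term sandwiches (shared with road P1 at source zero), the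
ℝ-kernel's sandwich algebra (`T4HybridMatching.prod_sandwich` ∕ `integral_sandwich`, ratios), this lemma}; the mean
defects of the bad class enter as on the law side (a defect version of this lemma is the obvious next item).  The
ONE-run part Q.old (old resampling times) is untouched by this file.

WHAT IS PROVED.
* `setIntegral_dressing_diff_eq` : the exact identity `∫_A (m_Q − m_P) dQ_Y = ∫_{Y⁻¹A} (d − 1)(Φ − m_P∘Y) dP`,
  `d = e^{f}/Z` the tilt density.
* `integral_abs_dressing_sub_le_of_sandwich` : `|f − c| ≤ R` ⇒ `∫ |m_Q − m_P| dQ_Y ≤ 2 e^{2R} (e^{2R} − 1)`.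
-/

noncomputable section

open MeasureTheory

namespace Summit.QuantumFields.BalabanUV.T4Continuum.NE7LawLevel

open Literature.MathematicalPhysics.QuantumFieldTheory.Balaban1983to89
open T4VarianceMatching

variable {Ω X : Type*} [MeasurableSpace Ω] [MeasurableSpace X]

/-- Bounds on the tilt density `d = e^{f}/∫e^{f}` from a sandwich `|f − c| ≤ R` on a probability space:
`e^{−2R} ≤ d ≤ e^{2R}`, hence `|d − 1| ≤ e^{2R} − 1` and `0 < d`. [folklore] -/
theorem tiltDensity_bounds (P : Measure Ω) [IsProbabilityMeasure P] {f : Ω → ℝ} (hf : Measurable f) {c R : ℝ}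
    (hR : ∀ ω, |f ω - c| ≤ R) (ω : Ω) :
    Real.exp (-(2 * R)) ≤ Real.exp (f ω) / ∫ x, Real.exp (f x) ∂P ∧
      Real.exp (f ω) / ∫ x, Real.exp (f x) ∂P ≤ Real.exp (2 * R) ∧
      |Real.exp (f ω) / ∫ x, Real.exp (f x) ∂P - 1| ≤ Real.exp (2 * R) - 1 := by
  have hlo : ∀ x, Real.exp (c - R) ≤ Real.exp (f x) := fun x =>
    Real.exp_le_exp.mpr (by linarith [(abs_le.mp (hR x)).1])
  have hhi : ∀ x, Real.exp (f x) ≤ Real.exp (c + R) := fun x =>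
    Real.exp_le_exp.mpr (by linarith [(abs_le.mp (hR x)).2])
  have hfi : Integrable (fun x => Real.exp (f x)) P :=
    integrable_of_abs_le P (hf.exp) (B := Real.exp (c + R)) fun x => by
      rw [abs_of_pos (Real.exp_pos _)]; exact hhi x
  have hZlo : Real.exp (c - R) ≤ ∫ x, Real.exp (f x) ∂P := by
    have := integral_mono (integrable_const (Real.exp (c - R))) hfi hlo
    simpa using this
  have hZhi : ∫ x, Real.exp (f x) ∂P ≤ Real.exp (c + R) := by
    have := integral_mono hfi (integrable_const (Real.exp (c + R))) hhi
    simpa using this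
  have hZpos : 0 < ∫ x, Real.exp (f x) ∂P := lt_of_lt_of_le (Real.exp_pos _) hZlo
  set Z := ∫ x, Real.exp (f x) ∂P with hZ
  have hR0 : 0 ≤ R := le_trans (abs_nonneg _) (hR ω)
  have h1 : Real.exp (-(2 * R)) ≤ Real.exp (f ω) / Z := by
    rw [le_div_iff₀ hZpos]
    calc Real.exp (-(2 * R)) * Z ≤ Real.exp (-(2 * R)) * Real.exp (c + R) :=
          mul_le_mul_of_nonneg_left hZhi (Real.exp_pos _).le
      _ = Real.exp (c - R) := by rw [← Real.exp_add]; ring_nf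
      _ ≤ Real.exp (f ω) := hlo ω
  have h2 : Real.exp (f ω) / Z ≤ Real.exp (2 * R) := by
    rw [div_le_iff₀ hZpos]
    calc Real.exp (f ω) ≤ Real.exp (c + R) := hhi ω
      _ = Real.exp (2 * R) * Real.exp (c - R) := by rw [← Real.exp_add]; ring_nf
      _ ≤ Real.exp (2 * R) * Z := mul_le_mul_of_nonneg_left hZlo (Real.exp_pos _).le
  refine ⟨h1, h2, abs_le.mpr ⟨?_, by linarith⟩⟩
  -- lower: -(e^{2R} - 1) ≤ d - 1, from e^{-2R} ≥ 2 - e^{2R}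
  have hprod : Real.exp (2 * R) * Real.exp (-(2 * R)) = 1 := by rw [← Real.exp_add]; simp
  have hge1 : 1 ≤ Real.exp (2 * R) := Real.one_le_exp (by linarith)
  nlinarith [Real.exp_pos (-(2 * R)), h1]

/-- **THE EXACT IDENTITY behind the stability of dressing means.**  `P` a probability law on paths, `Q = P.tilted f`
(`f` bounded measurable), `Y` the endpoint map, `Φ` a path functional with `|Φ| ≤ 1`, `m_P, m_Q` dressing means of `Φ`
given `Y` under `P`, `Q` (defining set-integral identities).  Then for every measurable `A`:
`∫_A (m_Q − m_P) dQ_Y = ∫_{Y⁻¹A} (d − 1)·(Φ − m_P∘Y) dP` with `d = e^{f}/∫e^{f}dP`. [folklore] -/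
theorem setIntegral_dressing_diff_eq (P : Measure Ω) [IsProbabilityMeasure P] {f : Ω → ℝ} (hf : Measurable f)
    {B : ℝ} (hfB : ∀ ω, |f ω| ≤ B) {Y : Ω → X} (hY : Measurable Y) {Φ : Ω → ℝ} (hΦm : Measurable Φ)
    (hΦb : ∀ ω, |Φ ω| ≤ 1) {mP mQ : X → ℝ} (hmPm : Measurable mP) (hmQm : Measurable mQ)
    (hbP : ∀ x, |mP x| ≤ 1) (hbQ : ∀ x, |mQ x| ≤ 1)
    (hP : ∀ A : Set X, MeasurableSet A → ∫ ω in Y ⁻¹' A, Φ ω ∂P = ∫ x in A, mP x ∂(P.map Y))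
    (hQ : ∀ A : Set X, MeasurableSet A →
      ∫ ω in Y ⁻¹' A, Φ ω ∂(P.tilted f) = ∫ x in A, mQ x ∂((P.tilted f).map Y))
    {A : Set X} (hA : MeasurableSet A) :
    ∫ x in A, (mQ x - mP x) ∂((P.tilted f).map Y) =
      ∫ ω in Y ⁻¹' A, (Real.exp (f ω) / ∫ x, Real.exp (f x) ∂P - 1) * (Φ ω - mP (Y ω)) ∂P := by
  have hfi : Integrable (fun x => Real.exp (f x)) P :=
    integrable_of_abs_le P hf.exp (B := Real.exp B) fun x => by
      rw [abs_of_pos (Real.exp_pos _)]; exact Real.exp_le_exp.mpr (abs_le.mp (hfB x)).2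
  haveI : IsProbabilityMeasure (P.tilted f) := isProbabilityMeasure_tilted hfi
  have hZpos : 0 < ∫ x, Real.exp (f x) ∂P := integral_exp_pos hfi
  have hdm : Measurable fun ω => Real.exp (f ω) / ∫ x, Real.exp (f x) ∂P := (hf.exp).div_const _
  have hdb : ∀ ω, |Real.exp (f ω) / ∫ x, Real.exp (f x) ∂P| ≤ Real.exp B / ∫ x, Real.exp (f x) ∂P := fun ω => by
    rw [abs_div, abs_of_pos (Real.exp_pos _), abs_of_pos hZpos]
    exact div_le_div_of_nonneg_right (Real.exp_le_exp.mpr (abs_le.mp (hfB ω)).2) hZpos.le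
  -- integrability kit
  have iΦ : Integrable Φ P := integrable_of_abs_le P hΦm (B := 1) hΦb
  have imPY : Integrable (fun ω => mP (Y ω)) P := integrable_of_abs_le P (hmPm.comp hY) (B := 1) fun ω => hbP _
  have idΦ : Integrable (fun ω => (Real.exp (f ω) / ∫ x, Real.exp (f x) ∂P) • Φ ω) P :=
    integrable_of_abs_le P (hdm.mul hΦm) (B := Real.exp B / (∫ x, Real.exp (f x) ∂P) * 1) fun ω => by
      rw [smul_eq_mul, abs_mul]; exact mul_le_mul (hdb ω) (hΦb ω) (abs_nonneg _) (by positivity)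
  have idm : Integrable (fun ω => (Real.exp (f ω) / ∫ x, Real.exp (f x) ∂P) • mP (Y ω)) P :=
    integrable_of_abs_le P (hdm.mul (hmPm.comp hY)) (B := Real.exp B / (∫ x, Real.exp (f x) ∂P) * 1)
      fun ω => by
      rw [smul_eq_mul, abs_mul]; exact mul_le_mul (hdb ω) (hbP _) (abs_nonneg _) (by positivity)
  have imQ : Integrable mQ ((P.tilted f).map Y) := integrable_of_abs_le _ hmQm (B := 1) hbQ
  have imP' : Integrable mP ((P.tilted f).map Y) := integrable_of_abs_le _ hmPm (B := 1) hbP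
  have hS : MeasurableSet (Y ⁻¹' A) := hY hA
  -- left side: split the difference, rewrite both pieces as P-integrals with the tilt density
  rw [integral_sub imQ.integrableOn imP'.integrableOn, ← hQ A hA,
    setIntegral_map hA hmPm.aestronglyMeasurable hY.aemeasurable,
    setIntegral_tilted' f Φ hS, setIntegral_tilted' f (fun ω => mP (Y ω)) hS]
  -- right side: expand (d − 1)(Φ − mP∘Y) = (d•Φ − d•mP∘Y) − (Φ − mP∘Y) and use ∫_S (Φ − mP∘Y) dP = 0
  have hzero : ∫ ω in Y ⁻¹' A, (Φ ω - mP (Y ω)) ∂P = 0 := by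
    rw [integral_sub iΦ.integrableOn imPY.integrableOn, hP A hA,
      setIntegral_map hA hmPm.aestronglyMeasurable hY.aemeasurable, sub_self]
  have hexp : ∀ ω, (Real.exp (f ω) / ∫ x, Real.exp (f x) ∂P - 1) * (Φ ω - mP (Y ω)) =
      ((Real.exp (f ω) / ∫ x, Real.exp (f x) ∂P) • Φ ω -
        (Real.exp (f ω) / ∫ x, Real.exp (f x) ∂P) • mP (Y ω)) - (Φ ω - mP (Y ω)) := fun ω => by
    simp only [smul_eq_mul]; ring
  have iA : Integrable (fun ω => (Real.exp (f ω) / ∫ x, Real.exp (f x) ∂P) • Φ ω -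
      (Real.exp (f ω) / ∫ x, Real.exp (f x) ∂P) • mP (Y ω)) P := idΦ.sub idm
  have iB : Integrable (fun ω => Φ ω - mP (Y ω)) P := iΦ.sub imPY
  rw [setIntegral_congr_fun hS (fun ω _ => hexp ω), integral_sub iA.integrableOn iB.integrableOn, hzero, sub_zero,
    integral_sub idΦ.integrableOn idm.integrableOn]

/-- **NODE Q.rec REDUCED — stability of conditional dressing means under a sandwiched tilt.**  In the setting of
`setIntegral_dressing_diff_eq`, if the path tilt is sandwiched, `|f − c| ≤ R` everywhere (the two runs' joint window
densities matched modulo the constant `c` within radius `R`), then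
`∫ |m_Q − m_P| dQ_Y ≤ 2 e^{2R} (e^{2R} − 1)` — whatever the bounded functional `Φ` and the endpoint map `Y`.
(For Bałaban's two runs: `R` = the sum over the recent window of the level radii of NODE S; the bound is `≈ 4R`,
summable in `K` when the window's radii are.) [folklore] -/
theorem integral_abs_dressing_sub_le_of_sandwich (P : Measure Ω) [IsProbabilityMeasure P] {f : Ω → ℝ}
    (hf : Measurable f) {c R : ℝ} (hR : ∀ ω, |f ω - c| ≤ R) {Y : Ω → X} (hY : Measurable Y) {Φ : Ω → ℝ}
    (hΦm : Measurable Φ) (hΦb : ∀ ω, |Φ ω| ≤ 1) {mP mQ : X → ℝ} (hmPm : Measurable mP) (hmQm : Measurable mQ)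
    (hbP : ∀ x, |mP x| ≤ 1) (hbQ : ∀ x, |mQ x| ≤ 1)
    (hP : ∀ A : Set X, MeasurableSet A → ∫ ω in Y ⁻¹' A, Φ ω ∂P = ∫ x in A, mP x ∂(P.map Y))
    (hQ : ∀ A : Set X, MeasurableSet A →
      ∫ ω in Y ⁻¹' A, Φ ω ∂(P.tilted f) = ∫ x in A, mQ x ∂((P.tilted f).map Y)) :
    ∫ x, |mQ x - mP x| ∂((P.tilted f).map Y) ≤ 2 * Real.exp (2 * R) * (Real.exp (2 * R) - 1) := by
  -- a bound B on |f| from the sandwich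
  have hfB : ∀ ω, |f ω| ≤ |c| + R := fun ω => by
    have := hR ω
    calc |f ω| = |(f ω - c) + c| := by ring_nf
      _ ≤ |f ω - c| + |c| := abs_add_le _ _
      _ ≤ |c| + R := by linarith
  set Z := ∫ x, Real.exp (f x) ∂P with hZ
  set d : Ω → ℝ := fun ω => Real.exp (f ω) / Z with hd
  set ρ : ℝ := Real.exp (2 * R) - 1 with hρ
  have hfi : Integrable (fun x => Real.exp (f x)) P :=
    integrable_of_abs_le P hf.exp (B := Real.exp (|c| + R)) fun x => by
      rw [abs_of_pos (Real.exp_pos _)]; exact Real.exp_le_exp.mpr (abs_le.mp (hfB x)).2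
  haveI hQprob : IsProbabilityMeasure (P.tilted f) := isProbabilityMeasure_tilted hfi
  haveI : IsProbabilityMeasure ((P.tilted f).map Y) := Measure.isProbabilityMeasure_map hY.aemeasurable
  have hdm : Measurable d := (hf.exp).div_const _
  have hbd : ∀ ω, |d ω - 1| ≤ ρ := fun ω => (tiltDensity_bounds P hf hR ω).2.2
  have hdlo : ∀ ω, Real.exp (-(2 * R)) ≤ d ω := fun ω => (tiltDensity_bounds P hf hR ω).1
  have hR0 : 0 ≤ R := by
    by_contra h
    push Not at h
    haveI : Nonempty Ω := by
      by_contra hne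
      rw [not_nonempty_iff] at hne
      have := IsProbabilityMeasure.measure_univ (μ := P)
      rw [Set.univ_eq_empty_iff.mpr hne, measure_empty] at this
      exact zero_ne_one this
    exact absurd (le_trans (abs_nonneg _) (hR (Classical.arbitrary Ω))) (not_le.mpr h)
  have hρ0 : 0 ≤ ρ := by rw [hρ]; linarith [Real.one_le_exp (show 0 ≤ 2 * R by linarith)]
  -- the per-set bound |D(A)| ≤ 2ρ e^{2R} Q_Y(A)
  have key : ∀ A : Set X, MeasurableSet A →
      |∫ x in A, (mQ x - mP x) ∂((P.tilted f).map Y)| ≤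
        2 * ρ * Real.exp (2 * R) * ((P.tilted f).map Y).real A := by
    intro A hA
    have hS : MeasurableSet (Y ⁻¹' A) := hY hA
    rw [setIntegral_dressing_diff_eq P hf hfB hY hΦm hΦb hmPm hmQm hbP hbQ hP hQ hA]
    -- |∫_S (d−1)(Φ − mP∘Y) dP| ≤ ∫_S 2ρ dP = 2ρ P(S)
    have hpt : ∀ ω, |(d ω - 1) * (Φ ω - mP (Y ω))| ≤ 2 * ρ := fun ω => by
      rw [abs_mul]
      have h2 : |Φ ω - mP (Y ω)| ≤ 2 := (abs_sub _ _).trans (by linarith [hΦb ω, hbP (Y ω)])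
      calc |d ω - 1| * |Φ ω - mP (Y ω)| ≤ ρ * 2 := mul_le_mul (hbd ω) h2 (abs_nonneg _) hρ0
        _ = 2 * ρ := by ring
    have hI : |∫ ω in Y ⁻¹' A, (d ω - 1) * (Φ ω - mP (Y ω)) ∂P| ≤ 2 * ρ * P.real (Y ⁻¹' A) := by
      have := norm_setIntegral_le_of_norm_le_const (μ := P) (s := Y ⁻¹' A)
        (f := fun ω => (d ω - 1) * (Φ ω - mP (Y ω))) (C := 2 * ρ) (measure_lt_top P _)
        (fun ω _ => by rw [Real.norm_eq_abs]; exact hpt ω)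
      rw [Real.norm_eq_abs] at this
      linarith [this, mul_comm (2 * ρ) (P.real (Y ⁻¹' A))]
    -- P(S) ≤ e^{2R} Q(S):  Q(S) = ∫_S d dP ≥ e^{-2R} P(S)
    have hQS : ((P.tilted f).map Y).real A = ∫ ω in Y ⁻¹' A, d ω ∂P := by
      rw [map_measureReal_apply hY hA, measureReal_def, tilted_apply_eq_ofReal_integral' f hS,
        ENNReal.toReal_ofReal (setIntegral_nonneg hS fun ω _ => ?_)]
      exact le_trans (Real.exp_pos _).le (hdlo ω)
    have hPS : P.real (Y ⁻¹' A) ≤ Real.exp (2 * R) * ((P.tilted f).map Y).real A := by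
      rw [hQS]
      have hdi : Integrable d P := integrable_of_abs_le P hdm (B := Real.exp (2 * R)) fun ω => by
        rw [abs_of_pos (lt_of_lt_of_le (Real.exp_pos _) (hdlo ω))]
        exact (tiltDensity_bounds P hf hR ω).2.1
      have h1 : ∫ ω in Y ⁻¹' A, Real.exp (-(2 * R)) ∂P ≤ ∫ ω in Y ⁻¹' A, d ω ∂P :=
        setIntegral_mono (integrable_const _).integrableOn hdi.integrableOn hdlo
      rw [setIntegral_const, smul_eq_mul] at h1
      have hprod : Real.exp (2 * R) * Real.exp (-(2 * R)) = 1 := by rw [← Real.exp_add]; simp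
      calc P.real (Y ⁻¹' A) = Real.exp (2 * R) * (P.real (Y ⁻¹' A) * Real.exp (-(2 * R))) := by
            rw [mul_comm (P.real _), ← mul_assoc, hprod, one_mul]
        _ ≤ Real.exp (2 * R) * ∫ ω in Y ⁻¹' A, d ω ∂P :=
            mul_le_mul_of_nonneg_left h1 (Real.exp_pos _).le
    calc |∫ ω in Y ⁻¹' A, (d ω - 1) * (Φ ω - mP (Y ω)) ∂P| ≤ 2 * ρ * P.real (Y ⁻¹' A) := hI
      _ ≤ 2 * ρ * (Real.exp (2 * R) * ((P.tilted f).map Y).real A) :=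
          mul_le_mul_of_nonneg_left hPS (by positivity)
      _ = 2 * ρ * Real.exp (2 * R) * ((P.tilted f).map Y).real A := by ring
  -- split ∫|g| over A₊ = {mP ≤ mQ} and its complement
  set ν := (P.tilted f).map Y with hν
  set g : X → ℝ := fun x => mQ x - mP x with hg
  have hgm : Measurable g := hmQm.sub hmPm
  have hgi : Integrable g ν := integrable_of_abs_le ν hgm (B := 2) fun x =>
    (abs_sub _ _).trans (by linarith [hbQ x, hbP x])
  have hAp : MeasurableSet {x | mP x ≤ mQ x} := measurableSet_le hmPm hmQm
  have hsplit := integral_add_compl hAp hgi.abs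
  rw [← hsplit]
  have e1 : ∫ x in {x | mP x ≤ mQ x}, |g x| ∂ν = ∫ x in {x | mP x ≤ mQ x}, g x ∂ν :=
    setIntegral_congr_fun hAp fun x hx => by
      simp only [Set.mem_setOf_eq] at hx; rw [hg]; exact abs_of_nonneg (by simp only; linarith)
  have e2 : ∫ x in {x | mP x ≤ mQ x}ᶜ, |g x| ∂ν = -∫ x in {x | mP x ≤ mQ x}ᶜ, g x ∂ν := by
    rw [← integral_neg]
    refine setIntegral_congr_fun hAp.compl fun x hx => ?_
    simp only [Set.mem_compl_iff, Set.mem_setOf_eq, not_le] at hx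
    rw [hg]; exact abs_of_neg (by simp only; linarith)
  rw [e1, e2]
  have k1 := key _ hAp
  have k2 := key _ hAp.compl
  have hsum : ν.real {x | mP x ≤ mQ x} + ν.real {x | mP x ≤ mQ x}ᶜ = 1 := by
    rw [measureReal_add_measureReal_compl (μ := ν) hAp, probReal_univ]
  have hnn : 0 ≤ 2 * ρ * Real.exp (2 * R) := by positivity
  calc ∫ x in {x | mP x ≤ mQ x}, g x ∂ν + -∫ x in {x | mP x ≤ mQ x}ᶜ, g x ∂ν
      ≤ |∫ x in {x | mP x ≤ mQ x}, g x ∂ν| + |∫ x in {x | mP x ≤ mQ x}ᶜ, g x ∂ν| :=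
        add_le_add (le_abs_self _) (neg_le_abs _)
    _ ≤ 2 * ρ * Real.exp (2 * R) * ν.real {x | mP x ≤ mQ x} +
          2 * ρ * Real.exp (2 * R) * ν.real {x | mP x ≤ mQ x}ᶜ := add_le_add k1 k2
    _ = 2 * ρ * Real.exp (2 * R) * (ν.real {x | mP x ≤ mQ x} + ν.real {x | mP x ≤ mQ x}ᶜ) := by ring
    _ = 2 * Real.exp (2 * R) * (Real.exp (2 * R) - 1) := by rw [hsum, hρ]; ring

end Summit.QuantumFields.BalabanUV.T4Continuum.NE7LawLevel

end
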